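import Literature.Computability.AlgebraicComplexity.GMQ16PDefinableDegenerations
import Literature.Computability.AlgebraicComplexity.VNPClosedUnderComposition
import Literature.Computability.AlgebraicComplexity.VNPClosedUnderCoefficients
import Literature.Computability.AlgebraicComplexity.ValiantConjectureEquivProofs
import HarnessLib

/-!
# `VNP` is closed under one-parameter degenerations of polynomial degree
# (Grochow–Mulmuley–Qiao 2016, Thm. 1(a) `VNP* = VNP` — the polynomial-degree case)

Theorem-only file (no definitions, no named facts). Source: J. A. Grochow, K. D. Mulmuley, Y. Qiao,
*Boundaries of VP and VNP*, ICALP 2016, arXiv:1605.02815 [GrochowMulmuleyQiao2016]: Theorem 1(a) /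
Theorem 6 (`VNP* ⊆ VNP`: `VNP` is closed under p-definable one-parameter degenerations, p. 4 and
p. 11–12) contains as its simplest case the degenerations OF POLYNOMIAL DEGREE (GMQ16 §3.3, the
format of Lemma 4.3, p. 12); this file proves that case on the tree's `VNP` closure engines:

* `GMQ2016.isVNPFamily_of_isDegenerationOfDegree` — if `g ∈ VNP` and each `f_n` is a one-parameter
  degeneration of `g_n` of degree `≤ K(n) = poly(n)` (`GMQ2016.IsDegenerationOfDegree`), then
  `f ∈ VNP`.  (The `VP` version is `GMQ2016.lemma_4_3_holds`.)

## Proof (homogenisation + one coefficient extraction)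

Let `D = deg g` and clear the pole: `t^K a^i_j(t) = P^i_j(t)` are honest polynomials.  The
degree-`D` homogenisation `g^h(x, z) = Σ_e z^{D-e} g_e(x)` is ONE coefficient of ONE product,
`g^h = [w^D] ((Σ_{i ≤ D} (wz)^i) · g(w·x))` (`homog_eq`), hence a `VNP` family when `g` is
(`IsVNPFamily.aeval`, `IsVNPFamily.mul`, Bürgisser's `IsVNPFamily.coeff`).  Substituting
`z ↦ t^K`, `x_i ↦ Y_i(t, x) = P^i_0(t) + Σ_j P^i_j(t) x_j` gives a polynomial `F(t, x) ∈ VNP` with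
`F = Σ_e t^{K(D-e)} g_e(Y)`, and homogeneity (`g_e(t^K y) = t^{Ke} g_e(y)`) shows that under `t ↦ T`
it becomes `T^{KD} · g(y(t))`; so `f = lim_{t→0} g(y(t))` is the coefficient of `t^{KD}` in `F`
(`eq_coeff_aeval_homog`), a `VNP` family by `IsVNPFamily.coeff` again.  Nothing here bears on
`VP ≠ VNP` itself.
-/

namespace Literature.Computability.AlgebraicComplexity.GMQ2016

open MvPolynomial LaurentPolynomial

/-! ### Laurent-polynomial bookkeeping (as in `GMQ16Lemma43Holds`) -/

section Laurent

variable {F : Type*} [CommRing F]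

/-- Coefficients of `C r · T^n`. [folklore] -/
private theorem coeff_C_mul_T'' (r : F) (n a : ℤ) :
    (LaurentPolynomial.C r * T n).coeff a = if a = n then r else 0 := by
  rw [← single_eq_C_mul_T, AddMonoidAlgebra.coeff_single, Finsupp.single_apply]; simp [eq_comm]

/-- Coefficients of `toLaurent p`. [folklore] -/
private theorem coeff_toLaurent_ite'' (p : Polynomial F) (a : ℤ) :
    (Polynomial.toLaurent p).coeff a = if 0 ≤ a then p.coeff a.toNat else 0 := by
  induction p using Polynomial.induction_on' with
  | add p q hp hq =>
    simp only [map_add, AddMonoidAlgebra.coeff_add, Finsupp.add_apply, hp, hq, Polynomial.coeff_add]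
    split_ifs <;> simp
  | monomial n r =>
    rw [Polynomial.toLaurent_C_mul_T, coeff_C_mul_T'', Polynomial.coeff_monomial]
    by_cases h : 0 ≤ a
    · rw [if_pos h]
      by_cases h' : a = n
      · subst h'; simp
      · rw [if_neg h', if_neg (by omega)]
    · rw [if_neg h, if_neg (by omega)]

/-- Coefficients of `q · T^n`. [folklore] -/
private theorem coeff_mul_T'' (q : F[T;T⁻¹]) (n a : ℤ) : (q * T n).coeff a = q.coeff (a - n) := by
  rw [T, AddMonoidAlgebra.coeff_mul_single_eq_coeff_mul (a - n)
    (fun m _ => by constructor <;> intro h <;> omega), mul_one]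

/-- Coefficients of `T^n · q`. [folklore] -/
private theorem coeff_T_mul'' (q : F[T;T⁻¹]) (n a : ℤ) : (T n * q).coeff a = q.coeff (a - n) := by
  rw [T_mul, coeff_mul_T'']

/-- A Laurent polynomial without negative powers is a polynomial. [folklore] -/
private theorem exists_toLaurent_eq_of_coeff_neg'' (q : F[T;T⁻¹])
    (h : ∀ z : ℤ, z < 0 → q.coeff z = 0) : ∃ p : Polynomial F, Polynomial.toLaurent p = q := by
  obtain ⟨n, p', hp'⟩ := exists_T_pow q
  have hdvd : (Polynomial.X : Polynomial F) ^ n ∣ p' := by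
    refine Polynomial.X_pow_dvd_iff.mpr fun d hd => ?_
    have := congrArg (fun x : F[T;T⁻¹] => x.coeff (d : ℤ)) hp'
    simp only [coeff_toLaurent_ite'', coeff_mul_T''] at this
    rw [if_pos (by omega), h _ (by omega)] at this
    simpa using this
  obtain ⟨p, rfl⟩ := hdvd
  refine ⟨p, ?_⟩
  have h2 : Polynomial.toLaurent p * T n = q * T n := by
    rw [← hp', map_mul, Polynomial.toLaurent_X_pow, mul_comm]
  exact (isUnit_T n).mul_left_injective h2

/-- **Clearing the pole**: a Laurent polynomial supported on `[-K, K]` times `T^K` is an honest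
polynomial of degree `≤ 2K`. [folklore] -/
private theorem exists_poly_of_hasDegreeLE' {l m K : ℕ} {a : Fin l → Option (Fin m) → F[T;T⁻¹]}
    (ha : HasDegreeLE K a) (i : Fin l) (j : Option (Fin m)) :
    ∃ p : Polynomial F, Polynomial.toLaurent p = a i j * T K ∧ p.natDegree ≤ 2 * K := by
  obtain ⟨p, hp⟩ := exists_toLaurent_eq_of_coeff_neg'' (a i j * T K) fun z hz => by
    rw [coeff_mul_T'']; exact ha i j _ (by omega)
  refine ⟨p, hp, ?_⟩
  rw [Polynomial.natDegree_le_iff_coeff_eq_zero]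
  intro N hN
  have := congrArg (fun x : F[T;T⁻¹] => x.coeff (N : ℤ)) hp
  simp only [coeff_toLaurent_ite'', coeff_mul_T'', Nat.cast_nonneg, if_true, Int.toNat_natCast] at this
  rw [this]; exact ha i j _ (by omega)

end Laurent

/-! ### Homogeneity, ring maps and `aeval` -/

section Transport

variable {R : Type*} [CommSemiring R]

/-- `g_e(c · y) = c^e · g_e(y)` for the degree-`e` homogeneous component. [folklore] -/
private theorem aeval_mul_homogeneousComponent' {σ B : Type*} [CommSemiring B] [Algebra R B]
    (s : σ → B) (c : B) (p : MvPolynomial σ R) (e : ℕ) :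
    aeval (fun i => c * s i) (homogeneousComponent e p) =
      c ^ e * aeval s (homogeneousComponent e p) := by
  classical
  rw [homogeneousComponent_apply, map_sum, map_sum, Finset.mul_sum]
  refine Finset.sum_congr rfl fun d hd => ?_
  rw [Finset.mem_filter] at hd
  rw [MvPolynomial.aeval_monomial, MvPolynomial.aeval_monomial, Finsupp.prod, Finsupp.prod]
  simp_rw [mul_pow]
  rw [Finset.prod_mul_distrib, Finset.prod_pow_eq_pow_sum, ← Finsupp.degree_apply, hd.2]
  ring

/-- A ring map compatible with the structure maps commutes with `aeval`. [folklore] -/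
private theorem ringHom_aeval' {σ A B : Type*} [CommSemiring A] [CommSemiring B] [Algebra R A]
    [Algebra R B] (Ψ : A →+* B) (hΨ : ∀ c : R, Ψ (algebraMap R A c) = algebraMap R B c)
    (s : σ → A) (p : MvPolynomial σ R) : Ψ (aeval s p) = aeval (fun i => Ψ (s i)) p := by
  induction p using MvPolynomial.induction_on with
  | C c => simp [hΨ]
  | add p q hp hq => simp [hp, hq]
  | mul_X p i hp => simp [hp]

/-- The coefficient of `w^D` in `w^n · C q` (one distinguished variable `w`). [folklore] -/
private theorem coeff_X_pow_mul_C {A : Type*} [CommSemiring A] (n D : ℕ) (q : A) :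
    MvPolynomial.coeff (Finsupp.single 0 D) ((X (0 : Fin 1)) ^ n * MvPolynomial.C q :
      MvPolynomial (Fin 1) A) = if n = D then q else 0 := by
  classical
  rw [X_pow_eq_monomial, mul_comm, C_mul_monomial, mul_one, MvPolynomial.coeff_monomial]
  by_cases h : n = D
  · rw [if_pos (by rw [h]), if_pos h]
  · rw [if_neg (fun h' => h (Finsupp.single_injective _ h')), if_neg h]

end Transport

/-! ### The homogenisation as one coefficient of one product -/

section Homog

variable {F : Type*} [CommRing F]

/-- **`[w^D] ((Σ_{i ≤ D} (wz)^i) · g(w x)) = Σ_{e ≤ D} z^{D-e} g_e(x)`** (`D = deg g`; `w` is the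
variable `inl 0`, `z` is `inr none`, `x_i` is `inr (some i)`; after extracting the `w`-coefficient the
variables are `z = none`, `x_i = some i`). [folklore] -/
private theorem homog_eq {l : ℕ} (g : MvPolynomial (Fin l) F) :
    MvPolynomial.coeff (Finsupp.single 0 g.totalDegree) (sumAlgEquiv F (Fin 1) (Option (Fin l))
      ((∑ i ∈ Finset.range (g.totalDegree + 1),
          ((X (Sum.inl 0) * X (Sum.inr none)) ^ i : MvPolynomial (Fin 1 ⊕ Option (Fin l)) F)) *
        aeval (fun i => (X (Sum.inl 0) * X (Sum.inr (some i)) :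
          MvPolynomial (Fin 1 ⊕ Option (Fin l)) F)) g)) =
    ∑ e ∈ Finset.range (g.totalDegree + 1), X none ^ (g.totalDegree - e) *
      aeval (fun i => (X (some i) : MvPolynomial (Option (Fin l)) F)) (homogeneousComponent e g) := by
  classical
  set D := g.totalDegree with hD
  set S := sumAlgEquiv F (Fin 1) (Option (Fin l)) with hS
  have hSC : ∀ c : F, S.toRingEquiv.toRingHom (algebraMap F _ c) = algebraMap F _ c := by
    intro c
    show S (algebraMap F (MvPolynomial (Fin 1 ⊕ Option (Fin l)) F) c) = _
    exact S.commutes c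
  have hCC : ∀ c : F, (MvPolynomial.C : MvPolynomial (Option (Fin l)) F →+*
      MvPolynomial (Fin 1) (MvPolynomial (Option (Fin l)) F)) (algebraMap F _ c) = algebraMap F _ c := by
    intro c
    conv_rhs => rw [MvPolynomial.algebraMap_apply]
  -- the scaled substitution under `S`
  have hSg : S (aeval (fun i => (X (Sum.inl 0) * X (Sum.inr (some i)) :
      MvPolynomial (Fin 1 ⊕ Option (Fin l)) F)) g) =
      ∑ e ∈ Finset.range (D + 1), X 0 ^ e * MvPolynomial.C
        (aeval (fun i => (X (some i) : MvPolynomial (Option (Fin l)) F)) (homogeneousComponent e g)) := by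
    have h1 : S (aeval (fun i => (X (Sum.inl 0) * X (Sum.inr (some i)) :
        MvPolynomial (Fin 1 ⊕ Option (Fin l)) F)) g) =
        aeval (fun i => (X 0 : MvPolynomial (Fin 1) (MvPolynomial (Option (Fin l)) F)) *
          MvPolynomial.C (X (some i))) g := by
      have := ringHom_aeval' S.toRingEquiv.toRingHom hSC
        (fun i => (X (Sum.inl 0) * X (Sum.inr (some i)) : MvPolynomial (Fin 1 ⊕ Option (Fin l)) F)) g
      refine this.trans ?_
      have hfun : (fun i => S.toRingEquiv.toRingHom ((X (Sum.inl 0) * X (Sum.inr (some i)) :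
          MvPolynomial (Fin 1 ⊕ Option (Fin l)) F))) = fun i =>
          (X 0 : MvPolynomial (Fin 1) (MvPolynomial (Option (Fin l)) F)) *
            MvPolynomial.C (X (some i)) := by
        funext i
        show S (X (Sum.inl 0) * X (Sum.inr (some i))) = _
        rw [map_mul, sumAlgEquiv_X_inl, sumAlgEquiv_X_inr]
      rw [hfun]
    rw [h1]
    conv_lhs => rw [← sum_homogeneousComponent g]
    rw [map_sum]
    refine Finset.sum_congr rfl fun e _ => ?_
    rw [aeval_mul_homogeneousComponent', ringHom_aeval' _ hCC]
  -- the geometric factor under `S`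
  have hSgeom : S (∑ i ∈ Finset.range (D + 1),
      ((X (Sum.inl 0) * X (Sum.inr none)) ^ i : MvPolynomial (Fin 1 ⊕ Option (Fin l)) F)) =
      ∑ i ∈ Finset.range (D + 1), X 0 ^ i * MvPolynomial.C (X none ^ i) := by
    rw [map_sum]
    refine Finset.sum_congr rfl fun i _ => ?_
    rw [map_pow, map_mul, sumAlgEquiv_X_inl, sumAlgEquiv_X_inr, mul_pow, ← map_pow]
  -- the product and its `w^D` coefficient
  show MvPolynomial.coeff (Finsupp.single 0 D) (S (_ * _)) = _
  rw [map_mul, hSgeom, hSg, Finset.sum_mul_sum, MvPolynomial.coeff_sum]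
  have hterm : ∀ i e : ℕ, (X 0 ^ i * MvPolynomial.C (X none ^ i) : MvPolynomial (Fin 1)
      (MvPolynomial (Option (Fin l)) F)) * (X 0 ^ e * MvPolynomial.C (aeval (fun i =>
        (X (some i) : MvPolynomial (Option (Fin l)) F)) (homogeneousComponent e g))) =
      X 0 ^ (i + e) * MvPolynomial.C (X none ^ i * aeval (fun i =>
        (X (some i) : MvPolynomial (Option (Fin l)) F)) (homogeneousComponent e g)) := by
    intro i e
    rw [pow_add, map_mul]
    ring
  simp_rw [hterm, MvPolynomial.coeff_sum, coeff_X_pow_mul_C]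
  rw [Finset.sum_comm]
  refine Finset.sum_congr rfl fun e he => ?_
  have heD : e ≤ D := Nat.lt_succ_iff.1 (Finset.mem_range.1 he)
  rw [Finset.sum_eq_single_of_mem (D - e) (Finset.mem_range.2 (by omega))]
  · rw [if_pos (Nat.sub_add_cancel heD)]
  · intro i _ hi
    rw [if_neg (by omega)]

/-- **The homogenisation substitutes homogeneously**: with `z ↦ c`, `x_i ↦ c · s_i` it becomes
`c^D · g(s)`. [folklore] -/
private theorem aeval_homog {l : ℕ} (g : MvPolynomial (Fin l) F) {B : Type*} [CommRing B]
    [Algebra F B] (c : B) (s : Fin l → B) :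
    aeval (fun o : Option (Fin l) => o.elim c fun i => c * s i)
      (MvPolynomial.coeff (Finsupp.single 0 g.totalDegree) (sumAlgEquiv F (Fin 1) (Option (Fin l))
        ((∑ i ∈ Finset.range (g.totalDegree + 1),
            ((X (Sum.inl 0) * X (Sum.inr none)) ^ i : MvPolynomial (Fin 1 ⊕ Option (Fin l)) F)) *
          aeval (fun i => (X (Sum.inl 0) * X (Sum.inr (some i)) :
            MvPolynomial (Fin 1 ⊕ Option (Fin l)) F)) g))) =
      c ^ g.totalDegree * aeval s g := by
  rw [homog_eq, map_sum]
  have hg : aeval s g = ∑ e ∈ Finset.range (g.totalDegree + 1), aeval s (homogeneousComponent e g) := by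
    conv_lhs => rw [← sum_homogeneousComponent g]
    rw [map_sum]
  rw [hg, Finset.mul_sum]
  refine Finset.sum_congr rfl fun e he => ?_
  have heD : e ≤ g.totalDegree := Nat.lt_succ_iff.1 (Finset.mem_range.1 he)
  rw [map_mul, map_pow, aeval_X, MvPolynomial.comp_aeval_apply]
  simp_rw [aeval_X]
  show c ^ (g.totalDegree - e) * aeval (fun i => c * s i) (homogeneousComponent e g) = _
  rw [aeval_mul_homogeneousComponent', ← mul_assoc, ← pow_add, Nat.sub_add_cancel heD]

end Homog

/-! ### Coefficient extraction through `t ↦ T` -/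

section Extract

variable {F : Type*} [CommRing F]

/-- Coefficient extraction through `Λ : F[x][w] → F[T,T⁻¹][x]`, `w ↦ T`:
`[T^N] (coeff_μ (Λ q)) = coeff_μ ([w^N] q)`. [folklore] -/
private theorem coeff_coeff_evalT₁ {m : ℕ} (q : MvPolynomial (Fin 1) (MvPolynomial (Fin m) F))
    (μ : Fin m →₀ ℕ) (N : ℕ) :
    (MvPolynomial.coeff μ (eval₂Hom (MvPolynomial.map LaurentPolynomial.C)
        (fun _ => (MvPolynomial.C (T 1) : MvPolynomial (Fin m) F[T;T⁻¹])) q)).coeff (N : ℤ) =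
      MvPolynomial.coeff μ (MvPolynomial.coeff (Finsupp.single 0 N) q) := by
  classical
  induction q using MvPolynomial.induction_on' with
  | add p q hp hq =>
    rw [map_add, MvPolynomial.coeff_add, AddMonoidAlgebra.coeff_add, Finsupp.add_apply, hp, hq,
      MvPolynomial.coeff_add, MvPolynomial.coeff_add]
  | monomial d q₀ =>
    have hd : d = Finsupp.single 0 (d 0) := by simpa using Finsupp.unique_single d
    rw [hd, eval₂Hom_monomial, Finsupp.prod_single_index (h := fun (_ : Fin 1) (k : ℕ) =>
        (MvPolynomial.C (T 1) : MvPolynomial (Fin m) F[T;T⁻¹]) ^ k) (pow_zero _), ← map_pow, T_pow, mul_one,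
      mul_comm, MvPolynomial.coeff_C_mul, MvPolynomial.coeff_map, T_mul, coeff_C_mul_T'',
      MvPolynomial.coeff_monomial]
    by_cases h : d 0 = N
    · rw [if_pos (by rw [h]), if_pos (by rw [h])]
    · rw [if_neg (by exact_mod_cast (Ne.symm h)), if_neg (fun h' => h (Finsupp.single_injective _ h')),
        MvPolynomial.coeff_zero]

end Extract

/-! ### The limit of a polynomial-degree degeneration is one coefficient -/

/-- **The extraction identity.**  Let `f = lim_{t → 0} g(a(t))` with `t^K a^i_j(t) = P^i_j(t)`
honest polynomials.  Then `f` is the coefficient of `t^{K · deg g}` (the variable `inl 0`) in the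
substitution `z ↦ t^K`, `x_i ↦ P^i_0(t) + Σ_j P^i_j(t) x_j` into the degree-`deg g` homogenisation
`Σ_e z^{deg g - e} g_e` of `g` — itself written as the coefficient `homog_eq`.
[cite: GrochowMulmuleyQiao2016, Lemma 4.3 and Thm. 1(a) (interpolation step)] -/
theorem eq_coeff_aeval_homog {l m K : ℕ} (g : MvPolynomial (Fin l) ℂ) (f : MvPolynomial (Fin m) ℂ)
    (a : Fin l → Option (Fin m) → ℂ[T;T⁻¹]) (hlim : IsLimit f (degenerate g a))
    (P : Fin l → Option (Fin m) → Polynomial ℂ) (hP : ∀ i j, Polynomial.toLaurent (P i j) = a i j * T K) :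
    f = MvPolynomial.coeff (Finsupp.single 0 (K * g.totalDegree)) (sumAlgEquiv ℂ (Fin 1) (Fin m)
      (aeval (fun o : Option (Fin l) => o.elim ((X (Sum.inl 0) : MvPolynomial (Fin 1 ⊕ Fin m) ℂ) ^ K)
          fun i => Polynomial.aeval (X (Sum.inl 0) : MvPolynomial (Fin 1 ⊕ Fin m) ℂ) (P i none) +
            ∑ j : Fin m, Polynomial.aeval (X (Sum.inl 0) : MvPolynomial (Fin 1 ⊕ Fin m) ℂ)
              (P i (some j)) * X (Sum.inr j))
        (MvPolynomial.coeff (Finsupp.single 0 g.totalDegree) (sumAlgEquiv ℂ (Fin 1) (Option (Fin l))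
          ((∑ i ∈ Finset.range (g.totalDegree + 1),
              ((X (Sum.inl 0) * X (Sum.inr none)) ^ i : MvPolynomial (Fin 1 ⊕ Option (Fin l)) ℂ)) *
            aeval (fun i => (X (Sum.inl 0) * X (Sum.inr (some i)) :
              MvPolynomial (Fin 1 ⊕ Option (Fin l)) ℂ)) g))))) := by
  classical
  set D := g.totalDegree with hD
  set HOM : MvPolynomial (Option (Fin l)) ℂ := MvPolynomial.coeff (Finsupp.single 0 D)
    (sumAlgEquiv ℂ (Fin 1) (Option (Fin l))
      ((∑ i ∈ Finset.range (D + 1),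
          ((X (Sum.inl 0) * X (Sum.inr none)) ^ i : MvPolynomial (Fin 1 ⊕ Option (Fin l)) ℂ)) *
        aeval (fun i => (X (Sum.inl 0) * X (Sum.inr (some i)) :
          MvPolynomial (Fin 1 ⊕ Option (Fin l)) ℂ)) g)) with hHOM
  set Yp : Option (Fin l) → MvPolynomial (Fin 1 ⊕ Fin m) ℂ := fun o =>
    o.elim ((X (Sum.inl 0) : MvPolynomial (Fin 1 ⊕ Fin m) ℂ) ^ K)
      fun i => Polynomial.aeval (X (Sum.inl 0) : MvPolynomial (Fin 1 ⊕ Fin m) ℂ) (P i none) +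
        ∑ j : Fin m, Polynomial.aeval (X (Sum.inl 0) : MvPolynomial (Fin 1 ⊕ Fin m) ℂ)
          (P i (some j)) * X (Sum.inr j) with hYp
  -- the ring map `w ↦ T`
  set Λ : MvPolynomial (Fin 1) (MvPolynomial (Fin m) ℂ) →+* MvPolynomial (Fin m) ℂ[T;T⁻¹] :=
    eval₂Hom (MvPolynomial.map LaurentPolynomial.C)
      (fun _ => (MvPolynomial.C (T 1) : MvPolynomial (Fin m) ℂ[T;T⁻¹])) with hΛ
  set Ψ : MvPolynomial (Fin 1 ⊕ Fin m) ℂ →+* MvPolynomial (Fin m) ℂ[T;T⁻¹] :=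
    Λ.comp (sumAlgEquiv ℂ (Fin 1) (Fin m)).toRingEquiv.toRingHom with hΨ
  have hΨapply : ∀ q, Ψ q = Λ (sumAlgEquiv ℂ (Fin 1) (Fin m) q) := fun q => rfl
  have hΛC : ∀ q : MvPolynomial (Fin m) ℂ, Λ (MvPolynomial.C q) = MvPolynomial.map LaurentPolynomial.C q :=
    fun q => by rw [hΛ, eval₂Hom_C]
  have hΛX : Λ (X 0) = MvPolynomial.C (T 1) := by rw [hΛ, eval₂Hom_X']
  have hΨC : ∀ c : ℂ, Ψ (algebraMap ℂ (MvPolynomial (Fin 1 ⊕ Fin m) ℂ) c) =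
      algebraMap ℂ (MvPolynomial (Fin m) ℂ[T;T⁻¹]) c := by
    intro c
    rw [hΨapply, MvPolynomial.algebraMap_eq, sumAlgEquiv_C_inl, hΛC, MvPolynomial.map_C,
      MvPolynomial.algebraMap_apply, ← LaurentPolynomial.C_eq_algebraMap]
  have hΨt : Ψ (X (Sum.inl 0)) = MvPolynomial.C (T 1) := by
    rw [hΨapply, sumAlgEquiv_X_inl, hΛX]
  have hΨx : ∀ j : Fin m, Ψ (X (Sum.inr j)) = X j := by
    intro j; rw [hΨapply, sumAlgEquiv_X_inr, hΛC, MvPolynomial.map_X]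
  have hΨι : ∀ p : Polynomial ℂ, Ψ (Polynomial.aeval (X (Sum.inl 0) : MvPolynomial (Fin 1 ⊕ Fin m) ℂ) p) =
      MvPolynomial.C (Polynomial.toLaurent p) := by
    intro p
    induction p using Polynomial.induction_on' with
    | add p q hp hq => rw [map_add, map_add, hp, hq, map_add, map_add]
    | monomial n c =>
      rw [Polynomial.aeval_monomial, map_mul, map_pow, hΨt, hΨC, MvPolynomial.algebraMap_apply,
        ← LaurentPolynomial.C_eq_algebraMap, ← map_pow, T_pow, mul_one, ← map_mul,
        Polynomial.toLaurent_C_mul_T]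
  have hΨY : ∀ o, Ψ (Yp o) =
      o.elim (MvPolynomial.C (T (K : ℤ))) fun i => MvPolynomial.C (T (K : ℤ)) * substForm a i := by
    rintro (_ | i)
    · show Ψ ((X (Sum.inl 0) : MvPolynomial (Fin 1 ⊕ Fin m) ℂ) ^ K) = MvPolynomial.C (T (K : ℤ))
      rw [map_pow, hΨt, ← map_pow, T_pow, mul_one]
    · show Ψ (Polynomial.aeval (X (Sum.inl 0) : MvPolynomial (Fin 1 ⊕ Fin m) ℂ) (P i none) +
        ∑ j : Fin m, Polynomial.aeval (X (Sum.inl 0) : MvPolynomial (Fin 1 ⊕ Fin m) ℂ)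
          (P i (some j)) * X (Sum.inr j)) = MvPolynomial.C (T (K : ℤ)) * substForm a i
      rw [map_add, map_sum, hΨι, hP, substForm, mul_add, Finset.mul_sum, ← map_mul,
        mul_comm (T (K : ℤ)) (a i none)]
      congr 1
      refine Finset.sum_congr rfl fun j _ => ?_
      rw [map_mul, hΨι, hΨx, hP, ← mul_assoc, ← map_mul, mul_comm (T (K : ℤ))]
  have hΨF : Ψ (aeval Yp HOM) = MvPolynomial.C (T ((K * D : ℕ) : ℤ)) * degenerate g a := by
    rw [ringHom_aeval' Ψ hΨC, (funext hΨY : (fun o => Ψ (Yp o)) = fun o =>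
      o.elim (MvPolynomial.C (T (K : ℤ))) fun i => MvPolynomial.C (T (K : ℤ)) * substForm a i), hHOM,
      aeval_homog g (MvPolynomial.C (T (K : ℤ))) (substForm a), ← map_pow, T_pow]
    unfold degenerate
    congr 3
    push_cast
    ring
  ext μ
  have h1 : MvPolynomial.coeff μ (Ψ (aeval Yp HOM)) =
      T ((K * D : ℕ) : ℤ) * MvPolynomial.coeff μ (degenerate g a) := by
    rw [hΨF, MvPolynomial.coeff_C_mul]
  have h2 : (MvPolynomial.coeff μ (Ψ (aeval Yp HOM))).coeff ((K * D : ℕ) : ℤ) =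
      (MvPolynomial.coeff μ (degenerate g a)).coeff 0 := by
    rw [h1, coeff_T_mul'', sub_self]
  rw [← (hlim μ).2, ← h2, hΨapply]
  exact coeff_coeff_evalT₁ _ μ (K * D)


/-! ### Cost and degree bookkeeping for the two substitutions -/

section Cost

variable {F : Type*} [Field F]

/-- `L(x^k) ≤ k`. [folklore] -/
private theorem complexity_X_pow_le₁ {σ : Type*} (o : σ) (k : ℕ) :
    complexity (X o ^ k : MvPolynomial σ F) ≤ k := by
  induction k with
  | zero => rw [pow_zero, ← MvPolynomial.C_1, complexity_C_holds (k := F)]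
  | succ k ih =>
    rw [pow_succ]
    refine (complexity_mul_le_holds _ _).trans ?_
    rw [complexity_X_holds (k := F)]; omega

/-- `L(p^i) ≤ i · (L(p) + 1)`. [folklore] -/
private theorem complexity_pow_le₁ {σ : Type*} (p : MvPolynomial σ F) (i : ℕ) :
    complexity (p ^ i) ≤ i * (complexity p + 1) := by
  induction i with
  | zero => rw [pow_zero, ← MvPolynomial.C_1, complexity_C_holds (k := F)]; exact Nat.zero_le _
  | succ i ih =>
    rw [pow_succ]
    refine (complexity_mul_le_holds _ _).trans ?_
    rw [Nat.succ_mul]; omega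

/-- A univariate polynomial of degree `≤ N` in the variable `x_t` costs `≤ (N+1)(N+2)`. [folklore] -/
private theorem complexity_aeval_X_le₁ {ι : Type*} (t : ι) {p : Polynomial F} {N : ℕ}
    (hp : p.natDegree ≤ N) :
    complexity (Polynomial.aeval (X t : MvPolynomial ι F) p) ≤ (N + 1) * (N + 2) := by
  rw [Polynomial.aeval_eq_sum_range' (Nat.lt_succ_of_le hp)]
  simp_rw [MvPolynomial.smul_eq_C_mul]
  refine (complexity_finset_sum_le _ _).trans ?_
  have h : ∑ k ∈ Finset.range (N + 1), complexity (MvPolynomial.C (p.coeff k) * X t ^ k :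
      MvPolynomial ι F) ≤ ∑ _k ∈ Finset.range (N + 1), (N + 1) := by
    refine Finset.sum_le_sum fun k hk => (complexity_mul_le_holds _ _).trans ?_
    rw [complexity_C_holds (k := F), zero_add]
    have := complexity_X_pow_le₁ (F := F) t k
    have hk' := Finset.mem_range.1 hk
    omega
  rw [Finset.sum_const, Finset.card_range, smul_eq_mul] at h
  rw [Finset.card_range]
  nlinarith [h]

/-- A univariate polynomial of degree `≤ N` in `x_t` has total degree `≤ N`. [folklore] -/
private theorem totalDegree_aeval_X_le₁ {ι : Type*} (t : ι) {p : Polynomial F} {N : ℕ}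
    (hp : p.natDegree ≤ N) : (Polynomial.aeval (X t : MvPolynomial ι F) p).totalDegree ≤ N := by
  rw [Polynomial.aeval_eq_sum_range' (Nat.lt_succ_of_le hp)]
  simp_rw [MvPolynomial.smul_eq_C_mul]
  refine totalDegree_finsetSum_le fun k hk => (totalDegree_mul _ _).trans ?_
  rw [totalDegree_C, zero_add, totalDegree_X_pow]
  exact Nat.lt_succ_iff.1 (Finset.mem_range.1 hk)

variable {m : ℕ}

/-- Cost of a polynomial-side affine form `Y = P₀(t) + Σ_j P_j(t) x_j`, `deg P ≤ N`:
`L(Y) ≤ (m+1)((N+1)(N+2)+2)`. [folklore] -/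
private theorem complexity_polyForm_le₁ {ι : Type*} (t : ι) (x : Fin m → ι)
    (P : Option (Fin m) → Polynomial F) {N : ℕ} (hP : ∀ j, (P j).natDegree ≤ N) :
    complexity (Polynomial.aeval (X t : MvPolynomial ι F) (P none) +
      ∑ j : Fin m, Polynomial.aeval (X t : MvPolynomial ι F) (P (some j)) * X (x j)) ≤
      (m + 1) * ((N + 1) * (N + 2) + 2) := by
  refine (complexity_add_le_holds _ _).trans ?_
  have h0 := complexity_aeval_X_le₁ t (hP none)
  have h1 := complexity_finset_sum_le (Finset.univ : Finset (Fin m)) fun j =>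
    Polynomial.aeval (X t : MvPolynomial ι F) (P (some j)) * X (x j)
  have h2 : ∑ j : Fin m, complexity (Polynomial.aeval (X t : MvPolynomial ι F) (P (some j)) * X (x j))
      ≤ ∑ _j : Fin m, ((N + 1) * (N + 2) + 1) := by
    refine Finset.sum_le_sum fun j _ => (complexity_mul_le_holds _ _).trans ?_
    rw [complexity_X_holds (k := F), add_zero]
    exact Nat.add_le_add_right (complexity_aeval_X_le₁ _ (hP (some j))) _
  rw [Finset.sum_const, Finset.card_univ, Fintype.card_fin, smul_eq_mul] at h2
  rw [Finset.card_univ, Fintype.card_fin] at h1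
  nlinarith [h0, h1, h2]

/-- Total degree of a polynomial-side affine form: `≤ N + 1`. [folklore] -/
private theorem totalDegree_polyForm_le₁ {ι : Type*} (t : ι) (x : Fin m → ι)
    (P : Option (Fin m) → Polynomial F) {N : ℕ} (hP : ∀ j, (P j).natDegree ≤ N) :
    (Polynomial.aeval (X t : MvPolynomial ι F) (P none) +
      ∑ j : Fin m, Polynomial.aeval (X t : MvPolynomial ι F) (P (some j)) * X (x j)).totalDegree ≤
      N + 1 := by
  refine (totalDegree_add _ _).trans (max_le ((totalDegree_aeval_X_le₁ t (hP none)).trans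
    (Nat.le_succ N)) ?_)
  refine totalDegree_finsetSum_le fun j _ => (totalDegree_mul _ _).trans ?_
  rw [totalDegree_X]
  exact Nat.add_le_add_right (totalDegree_aeval_X_le₁ t (hP (some j))) 1

end Cost

/-! ### The theorem -/

/-- **`VNP` is closed under one-parameter degenerations of polynomial degree** (the
polynomial-degree case of GMQ16 Thm. 1(a) `VNP* = VNP`): if `g ∈ VNP` and each `f_n` is a
one-parameter degeneration of `g_n` of degree `≤ K(n)` with `K` p-bounded, then `f ∈ VNP`.
Proof: `f_n` is one `t`-coefficient of the substitution of polynomial-side forms into the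
homogenisation of `g_n` (`eq_coeff_aeval_homog`), the homogenisation is one `w`-coefficient of
`(Σ_{i ≤ deg g} (wz)^i) · g_n(w x)` (`homog_eq`), and `VNP` is closed under polynomial substitution,
products and taking coefficients (`IsVNPFamily.aeval`, `IsVNPFamily.mul`, `IsVNPFamily.coeff`).
[cite: GrochowMulmuleyQiao2016, Thm. 1(a) (polynomial-degree case) and Lemma 4.3] -/
theorem isVNPFamily_of_isDegenerationOfDegree :
    ∀ (l v : ℕ → ℕ) (g : ∀ n, MvPolynomial (Fin (l n)) ℂ) (f : ∀ n, MvPolynomial (Fin (v n)) ℂ)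
      (K : ℕ → ℕ), IsPBounded l → IsPBounded v → IsPBounded K → IsVNPFamily g →
      (∀ n, IsDegenerationOfDegree (K n) (g n) (f n)) → IsVNPFamily f := by
  intro l v g f K hl hv hK hg hdeg
  classical
  choose a ha hlim using hdeg
  choose P hP hPdeg using fun n i j => exists_poly_of_hasDegreeLE' (ha n) i j
  set D : ℕ → ℕ := fun n => (g n).totalDegree with hDdef
  have hD : IsPBounded D := hg.1.2
  have c1 := IsPBounded.const 1
  have c2 := IsPBounded.const 2
  -- the players
  set geom : ∀ n, MvPolynomial (Fin 1 ⊕ Option (Fin (l n))) ℂ := fun n =>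
    ∑ i ∈ Finset.range (D n + 1), (X (Sum.inl 0) * X (Sum.inr none)) ^ i with hgeom
  set sc : ∀ n, Fin (l n) → MvPolynomial (Fin 1 ⊕ Option (Fin (l n))) ℂ := fun n i =>
    X (Sum.inl 0) * X (Sum.inr (some i)) with hsc
  set Yp : ∀ n, Option (Fin (l n)) → MvPolynomial (Fin 1 ⊕ Fin (v n)) ℂ := fun n o =>
    o.elim ((X (Sum.inl 0) : MvPolynomial (Fin 1 ⊕ Fin (v n)) ℂ) ^ K n)
      fun i => Polynomial.aeval (X (Sum.inl 0) : MvPolynomial (Fin 1 ⊕ Fin (v n)) ℂ) (P n i none) +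
        ∑ j : Fin (v n), Polynomial.aeval (X (Sum.inl 0) : MvPolynomial (Fin 1 ⊕ Fin (v n)) ℂ)
          (P n i (some j)) * X (Sum.inr j) with hYp
  -- (1) the geometric factor is a `VP`, hence `VNP`, family
  have hcard : IsPBounded fun n => Fintype.card (Fin 1 ⊕ Option (Fin (l n))) :=
    (c1.add_holds (hl.add_holds c1)).mono fun n => by simp
  have hwdeg : ∀ n, ((X (Sum.inl 0) * X (Sum.inr none) :
      MvPolynomial (Fin 1 ⊕ Option (Fin (l n))) ℂ)).totalDegree ≤ 2 := fun n =>
    (totalDegree_mul _ _).trans (by rw [totalDegree_X, totalDegree_X])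
  have hwcost : ∀ n, complexity ((X (Sum.inl 0) * X (Sum.inr none) :
      MvPolynomial (Fin 1 ⊕ Option (Fin (l n))) ℂ)) ≤ 1 := fun n =>
    (complexity_mul_le_holds _ _).trans (by rw [complexity_X_holds (k := ℂ), complexity_X_holds (k := ℂ)])
  have hgeomVP : IsVPFamily geom := by
    refine ⟨⟨hcard, (c2.mul_holds hD).mono fun n => ?_⟩,
      ((hD.add_holds c1).mul_holds ((c2.mul_holds hD).add_holds c1)).mono fun n => ?_⟩
    · show (geom n).totalDegree ≤ 2 * D n
      refine totalDegree_finsetSum_le fun i hi => (totalDegree_pow _ _).trans ?_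
      have hi' := Nat.lt_succ_iff.1 (Finset.mem_range.1 hi)
      calc i * ((X (Sum.inl 0) * X (Sum.inr none) : MvPolynomial (Fin 1 ⊕ Option (Fin (l n))) ℂ)).totalDegree
          ≤ D n * 2 := Nat.mul_le_mul hi' (hwdeg n)
        _ = 2 * D n := mul_comm _ _
    · show complexity (geom n) ≤ (D n + 1) * (2 * D n + 1)
      refine (complexity_finset_sum_le _ _).trans ?_
      rw [Finset.card_range]
      have hs : ∑ i ∈ Finset.range (D n + 1), complexity (((X (Sum.inl 0) * X (Sum.inr none)) ^ i :
          MvPolynomial (Fin 1 ⊕ Option (Fin (l n))) ℂ)) ≤ ∑ _i ∈ Finset.range (D n + 1), 2 * D n := by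
        refine Finset.sum_le_sum fun i hi => (complexity_pow_le₁ _ _).trans ?_
        have hi' := Nat.lt_succ_iff.1 (Finset.mem_range.1 hi)
        have hw := hwcost n
        calc i * (complexity ((X (Sum.inl 0) * X (Sum.inr none) :
              MvPolynomial (Fin 1 ⊕ Option (Fin (l n))) ℂ)) + 1) ≤ D n * 2 :=
            Nat.mul_le_mul hi' (by omega)
          _ = 2 * D n := mul_comm _ _
      rw [Finset.sum_const, Finset.card_range, smul_eq_mul] at hs
      nlinarith [hs]
  have hgeomVNP : IsVNPFamily geom := IsVPFamily.isVNPFamily_holds' hgeomVP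
  -- (2) the scaled family `g_n(w x)` is a `VNP` family
  have hscVNP : IsVNPFamily fun n => aeval (sc n) (g n) := by
    refine hg.aeval sc hcard (c2.mono fun n => Finset.sup_le fun i _ => ?_) (hl.mono fun n => ?_)
    · show (sc n i).totalDegree ≤ 2
      exact (totalDegree_mul _ _).trans (by rw [totalDegree_X, totalDegree_X])
    · show ∑ i, complexity (sc n i) ≤ l n
      calc ∑ i, complexity (sc n i) ≤ ∑ _i : Fin (l n), 1 := Finset.sum_le_sum fun i _ =>
              (complexity_mul_le_holds _ _).trans
                (by rw [complexity_X_holds (k := ℂ), complexity_X_holds (k := ℂ)])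
        _ = l n := by simp
  -- (3) the homogenisation family is a `VNP` family (one coefficient of the product)
  have hHOM : IsVNPFamily (σ := fun n => Option (Fin (l n))) fun n =>
      MvPolynomial.coeff (Finsupp.single 0 (D n))
        (sumAlgEquiv ℂ (Fin 1) (Option (Fin (l n))) (geom n * aeval (sc n) (g n))) :=
    (hgeomVNP.mul hscVNP).coeff (a := fun _ => 1) fun n => Finsupp.single 0 (D n)
  -- (4) substitute the polynomial-side forms
  have hcard' : IsPBounded fun n => Fintype.card (Fin 1 ⊕ Fin (v n)) :=
    (c1.add_holds hv).mono fun n => by simp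
  have h2K : IsPBounded fun n => 2 * K n := c2.mul_holds hK
  have hF : IsVNPFamily (σ := fun n => Fin 1 ⊕ Fin (v n)) fun n => aeval (Yp n)
      (MvPolynomial.coeff (Finsupp.single 0 (D n))
        (sumAlgEquiv ℂ (Fin 1) (Option (Fin (l n))) (geom n * aeval (sc n) (g n)))) := by
    refine hHOM.aeval Yp hcard' ((h2K.add_holds c1).mono fun n => Finset.sup_le fun o _ => ?_)
      ((hK.add_holds (hl.mul_holds ((hv.add_holds c1).mul_holds
        (((h2K.add_holds c1).mul_holds (h2K.add_holds c2)).add_holds c2)))).mono fun n => ?_)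
    · rcases o with _ | i
      · show (((X (Sum.inl 0) : MvPolynomial (Fin 1 ⊕ Fin (v n)) ℂ)) ^ K n).totalDegree ≤ 2 * K n + 1
        rw [totalDegree_X_pow]; omega
      · exact totalDegree_polyForm_le₁ _ _ (P n i) (hPdeg n i)
    · show ∑ o, complexity (Yp n o) ≤
        K n + l n * ((v n + 1) * ((2 * K n + 1) * (2 * K n + 2) + 2))
      rw [Fintype.sum_option]
      refine Nat.add_le_add (complexity_X_pow_le₁ _ _) ?_
      calc ∑ i : Fin (l n), complexity (Yp n (some i))
          ≤ ∑ _i : Fin (l n), (v n + 1) * ((2 * K n + 1) * (2 * K n + 2) + 2) :=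
            Finset.sum_le_sum fun i _ => complexity_polyForm_le₁ _ _ (P n i) (hPdeg n i)
        _ = l n * ((v n + 1) * ((2 * K n + 1) * (2 * K n + 2) + 2)) := by
            rw [Finset.sum_const, Finset.card_univ, Fintype.card_fin, smul_eq_mul]
  -- (5) `f_n` is one coefficient of that family
  have hf : f = fun n => MvPolynomial.coeff (Finsupp.single 0 (K n * D n))
      (sumAlgEquiv ℂ (Fin 1) (Fin (v n)) (aeval (Yp n)
        (MvPolynomial.coeff (Finsupp.single 0 (D n))
          (sumAlgEquiv ℂ (Fin 1) (Option (Fin (l n))) (geom n * aeval (sc n) (g n)))))) := by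
    funext n
    exact eq_coeff_aeval_homog (g n) (f n) (a n) (hlim n) (P n) (hP n)
  rw [hf]
  exact hF.coeff (a := fun _ => 1) fun n => Finsupp.single 0 (K n * D n)

end Literature.Computability.AlgebraicComplexity.GMQ2016
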